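import Mathlib
import HarnessLib.Audit
import Summits.PneNP.PneNP.Theorems.PstarGConstraint
import Summits.PneNP.PneNP.Theorems.PstarGapTwoReaders
import Summits.PneNP.PneNP.Theorems.PstarGapPeeling
import Summits.PneNP.PneNP.Theorems.PstarCentreFree

/-!
# Reader substitution into G-constraints: the core of an output set (ROUND-24, preprocessing for `|W| ≥ 2`, memo R10(q)(b)/(v))

FRONTIER range-avoidance ladder, rung F-N3, ROUND 24 (cell `pnp-ideate`; restricted-model proof complexity — nothing here bears
on `P` versus `NP`).

A READER of an output set `J` is an output `g = (t_g, t'_g; p_g, q_g)` of `J` whose two XOR slots are `J`-private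
(`PstarGapTwoReaders.IsReader`).  Solving every reader of a set `R ⊆ J` for its second tip, `x_{t'_g} = x_{t_g} + y_g + a_{p_g} a_{q_g}`,
turns a G-constraint `Σ_C z + Σ_{G} z_p z_q = b` (`PstarGapOneAll.gval`, `G` disjoint from `R`) into the G-constraint with

* linear part `subC R C = (C ∖ {t'_g : g ∈ R}) △ {t_g : g ∈ R, t'_g ∈ C}`,
* monomial set `subG R C G = G ∪ {g ∈ R : t'_g ∈ C}`,
* constant `subb R C b = b ⊕ ⊕_{g ∈ R, t'_g ∈ C} y_g`.

This file proves the pointwise calculus of that substitution (the planner's preprocessing for the `|W| ≥ 2` analysis, memo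
ROUND-24-PRESEED §13 R10(q)(b) and R10(v); the all-readers / edge-language special case is `PstarGapTwoReadersProof`):
`bit_gval_sub` — at EVERY assignment `gval (subC) (subG) = gval C G ⊕ ⊕_{g ∈ R, t'_g ∈ C} out_g(z)`; hence on solutions of `R` the
substituted constraint is the original one (`gval_sub_iff_of_solves`), on an assignment violating exactly one reader `g₀` of `R` it
flips iff `t'_{g₀} ∈ C` (`gval_sub_iff_of_almost`); substituted constraints do not read second tips (`gval_sub_congr`), and every
assignment can be corrected on the second tips of `R` to solve `R` without touching any other output of `J` (`exists_fix_readers`).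
The system-level consequences (feasibility of `J` = feasibility of the core `J ∖ R` under the substituted system; transfer of
minimality) are in `PstarReaderCoreSystem`.
-/

set_option linter.dupNamespace false

open Finset Literature.Computability.Complexity
open scoped symmDiff
open Summit.PneNP.PneNP.Theorems.PstarPDT (parity)
open Summit.PneNP.PneNP.Theorems.PstarTyped (Typed)
open Summit.PneNP.PneNP.Theorems.PstarSALevel (varSet)
open Summit.PneNP.PneNP.Theorems.PstarGapPeeling (eval_pure eval_congr)
open Summit.PneNP.PneNP.Theorems.PstarCentreFree (vars_mem_varSet)
open Summit.PneNP.PneNP.Theorems.PstarFibrePolys (bit bit_xor bit_and bit_injective)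
open Summit.PneNP.PneNP.Theorems.PstarGraphQuadGapOne (bit_parity)
open Summit.PneNP.PneNP.Theorems.PstarGraphQuadGapTwoForms (sum_symmDiff_zmod2)
open Summit.PneNP.PneNP.Theorems.PstarGapOneAll (gval)
open Summit.PneNP.PneNP.Theorems.PstarGConstraint (bit_gval)
open Summit.PneNP.PneNP.Theorems.PstarGapTwoReaders (IsReader)

namespace Summit.PneNP.PneNP.Theorems.PstarReaderCore

variable {n m : ℕ}

/-- In `𝔽₂`, `x + x = 0`. -/
private theorem zmod2_add_self (x : ZMod 2) : x + x = 0 := by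
  revert x; decide

/-! ## The substituted constraint -/

/-- Linear part after substituting the readers of `R` for their second tips. -/
def subC (I : LocalMap 4 n m) (R : Finset (Fin m)) (C : Finset (Fin n)) : Finset (Fin n) :=
  (C \ R.image fun g => I.vars g 1) ∆ ((R.filter fun g => I.vars g 1 ∈ C).image fun g => I.vars g 0)

/-- Monomial set after the substitution: the old monomials and the readers whose second tip was read. -/
def subG (I : LocalMap 4 n m) (R : Finset (Fin m)) (C : Finset (Fin n)) (G : Finset (Fin m)) : Finset (Fin m) :=
  G ∪ R.filter fun g => I.vars g 1 ∈ C

/-- Constant after the substitution. -/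
def subb (I : LocalMap 4 n m) (R : Finset (Fin m)) (y : Fin m → Bool) (C : Finset (Fin n)) (b : Bool) : Bool :=
  xor b (parity (R.filter fun g => I.vars g 1 ∈ C) y)

/-- The readers of `R` whose second tip lies in `C`. -/
theorem mem_subG_iff (I : LocalMap 4 n m) (R : Finset (Fin m)) (C : Finset (Fin n)) (G : Finset (Fin m)) (g : Fin m) :
    g ∈ subG I R C G ↔ g ∈ G ∨ (g ∈ R ∧ I.vars g 1 ∈ C) := by
  unfold subG
  rw [mem_union, mem_filter]

/-- The constant, in `𝔽₂`. -/
theorem bit_subb (I : LocalMap 4 n m) (R : Finset (Fin m)) (y : Fin m → Bool) (C : Finset (Fin n)) (b : Bool) :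
    bit (subb I R y C b) = bit b + ∑ g ∈ R.filter (fun g => I.vars g 1 ∈ C), bit (y g) := by
  unfold subb
  rw [bit_xor, bit_parity]

section Readers

variable (I : LocalMap 4 n m) (hI : I.IsPure xorAndPred) (hT : Typed I) {J R : Finset (Fin m)} (hRJ : R ⊆ J)
  (hR : ∀ g ∈ R, IsReader I J g) (y : Fin m → Bool)

include hI hRJ hR in
/-- Tips of readers: `t_g ≠ t'_h` for `g, h ∈ R`. -/
theorem tip_ne_tip' {g h : Fin m} (hg : g ∈ R) (hh : h ∈ R) : I.vars g 0 ≠ I.vars h 1 := by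
  intro heq
  by_cases hgh : h = g
  · subst hgh; exact absurd (hI.2 h heq) (by decide)
  · exact hR h hh 1 (by decide) g (hRJ hg) (Ne.symm hgh) (heq ▸ vars_mem_varSet I g 0)

include hRJ hR in
/-- Second tips of distinct readers differ. -/
theorem tip'_injOn {g h : Fin m} (hg : g ∈ R) (hh : h ∈ R) (heq : I.vars g 1 = I.vars h 1) : g = h := by
  by_contra hgh
  exact hR h hh 1 (by decide) g (hRJ hg) hgh (heq ▸ vars_mem_varSet I g 1)

include hRJ hR in
/-- First tips of distinct readers differ. -/
theorem tip_injOn {g h : Fin m} (hg : g ∈ R) (hh : h ∈ R) (heq : I.vars g 0 = I.vars h 0) : g = h := by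
  by_contra hgh
  exact hR h hh 0 (by decide) g (hRJ hg) hgh (heq ▸ vars_mem_varSet I g 0)

include hR in
/-- A second tip of a reader of `R` is read by no other output of `J`. -/
theorem tip'_not_mem_varSet {g j : Fin m} (hg : g ∈ R) (hj : j ∈ J) (hne : j ≠ g) : I.vars g 1 ∉ varSet I j :=
  hR g hg 1 (by decide) j hj hne

include hI hRJ hR in
/-- **The substitution identity**: at every assignment,
`gval (subC R C) (subG R C G) = gval C G ⊕ ⊕_{g ∈ R, t'_g ∈ C} out_g(z)` (in `𝔽₂`), for `G` disjoint from `R`. -/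
theorem bit_gval_sub (C : Finset (Fin n)) {G : Finset (Fin m)} (hGR : Disjoint G R) (z : Fin n → Bool) :
    bit (gval I (subC I R C) (subG I R C G) z) =
      bit (gval I C G z) + ∑ g ∈ R.filter (fun g => I.vars g 1 ∈ C), bit (I.eval z g) := by
  classical
  set R₁ := R.filter fun g => I.vars g 1 ∈ C with hR₁
  have hR₁R : ∀ g ∈ R₁, g ∈ R := fun g hg => (mem_filter.1 hg).1
  rw [bit_gval, bit_gval]
  unfold subC subG
  simp only [← hR₁]
  -- monomials
  have hGR₁ : Disjoint G R₁ := hGR.mono_right (filter_subset _ _)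
  rw [sum_union hGR₁]
  -- linear part
  have hX : C ∩ R.image (fun g => I.vars g 1) = R₁.image fun g => I.vars g 1 := by
    ext v
    simp only [mem_inter, mem_image, hR₁, mem_filter]
    constructor
    · rintro ⟨hv, g, hg, rfl⟩; exact ⟨g, ⟨hg, hv⟩, rfl⟩
    · rintro ⟨g, ⟨hg, hv⟩, rfl⟩; exact ⟨hv, g, hg, rfl⟩
  have h3 : ∑ v ∈ R₁.image (fun g => I.vars g 1), bit (z v) = ∑ g ∈ R₁, bit (z (I.vars g 1)) :=
    sum_image fun g hg h hh he => tip'_injOn I hRJ hR (hR₁R g hg) (hR₁R h hh) he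
  have h1 : ∑ v ∈ C \ R.image (fun g => I.vars g 1), bit (z v) + ∑ g ∈ R₁, bit (z (I.vars g 1)) = ∑ v ∈ C, bit (z v) := by
    rw [← h3, ← hX, ← sdiff_inter_self_left, sum_sdiff inter_subset_left]
  have h2 : ∑ v ∈ R₁.image (fun g => I.vars g 0), bit (z v) = ∑ g ∈ R₁, bit (z (I.vars g 0)) :=
    sum_image fun g hg h hh he => tip_injOn I hRJ hR (hR₁R g hg) (hR₁R h hh) he
  have hl : ∑ v ∈ (C \ R.image fun g => I.vars g 1) ∆ (R₁.image fun g => I.vars g 0), bit (z v) =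
      ∑ v ∈ C, bit (z v) + ∑ g ∈ R₁, bit (z (I.vars g 1)) + ∑ g ∈ R₁, bit (z (I.vars g 0)) := by
    rw [sum_symmDiff_zmod2, h2, ← h1]
    have := zmod2_add_self (∑ g ∈ R₁, bit (z (I.vars g 1)))
    linear_combination -this
  have he : ∑ g ∈ R₁, bit (I.eval z g) =
      ∑ g ∈ R₁, bit (z (I.vars g 0)) + ∑ g ∈ R₁, bit (z (I.vars g 1)) + ∑ g ∈ R₁, bit (z (I.vars g 2)) * bit (z (I.vars g 3)) := by
    rw [← sum_add_distrib, ← sum_add_distrib]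
    refine sum_congr rfl fun g _ => ?_
    rw [eval_pure I hI, bit_xor, bit_xor, bit_and]
  rw [hl, he]
  ring

include hI hRJ hR in
/-- **On a solution of the readers** the substituted constraint is equivalent to the original one. -/
theorem gval_sub_iff_of_solves (C : Finset (Fin n)) {G : Finset (Fin m)} (hGR : Disjoint G R) (b : Bool) {z : Fin n → Bool}
    (hz : ∀ g ∈ R, I.eval z g = y g) :
    gval I (subC I R C) (subG I R C G) z = subb I R y C b ↔ gval I C G z = b := by
  classical
  rw [← bit_injective.eq_iff, ← bit_injective.eq_iff (a := gval I C G z), bit_gval_sub I hI hRJ hR C hGR z, bit_subb]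
  have hsum : ∑ g ∈ R.filter (fun g => I.vars g 1 ∈ C), bit (I.eval z g) = ∑ g ∈ R.filter (fun g => I.vars g 1 ∈ C), bit (y g) :=
    sum_congr rfl fun g hg => by rw [hz g (mem_filter.1 hg).1]
  rw [hsum]
  constructor
  · intro h; exact add_right_cancel h
  · intro h; rw [h]

include hI hRJ hR in
/-- **On an almost-solution of the readers** (`g₀ ∈ R` violated, the others solved) that satisfies the original constraint, the
substituted constraint holds iff the second tip of `g₀` is NOT read. -/
theorem gval_sub_iff_of_almost (C : Finset (Fin n)) {G : Finset (Fin m)} (hGR : Disjoint G R) (b : Bool) {z : Fin n → Bool}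
    {g₀ : Fin m} (hg₀ : g₀ ∈ R) (hz : ∀ g ∈ R, g ≠ g₀ → I.eval z g = y g) (hv : I.eval z g₀ ≠ y g₀) (hb : gval I C G z = b) :
    gval I (subC I R C) (subG I R C G) z = subb I R y C b ↔ I.vars g₀ 1 ∉ C := by
  classical
  set R₁ := R.filter fun g => I.vars g 1 ∈ C with hR₁
  have hbit : bit (I.eval z g₀) = bit (y g₀) + 1 := by
    revert hv
    cases I.eval z g₀ <;> cases y g₀ <;> decide
  have hq : gval I (subC I R C) (subG I R C G) z = subb I R y C b ↔ ∑ g ∈ R₁, bit (I.eval z g) = ∑ g ∈ R₁, bit (y g) := by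
    rw [← bit_injective.eq_iff, bit_gval_sub I hI hRJ hR C hGR z, bit_subb, ← hR₁, hb]
    constructor
    · intro h; exact add_left_cancel h
    · intro h; rw [h]
  rw [hq]
  by_cases hmem : I.vars g₀ 1 ∈ C
  · have hg₀R₁ : g₀ ∈ R₁ := mem_filter.2 ⟨hg₀, hmem⟩
    simp only [hmem, not_true_eq_false, iff_false]
    intro h
    rw [← add_sum_erase _ _ hg₀R₁, ← add_sum_erase _ (fun g => bit (y g)) hg₀R₁, hbit,
      sum_congr rfl fun g hg => by rw [hz g (mem_filter.1 (mem_of_mem_erase hg)).1 (ne_of_mem_erase hg)]] at h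
    have h1 : (1 : ZMod 2) = 0 := by linear_combination h
    exact absurd h1 (by decide)
  · simp only [hmem, not_false_eq_true, iff_true]
    refine sum_congr rfl fun g hg => ?_
    have hne : g ≠ g₀ := fun h => hmem (h ▸ (mem_filter.1 hg).2)
    rw [hz g (mem_filter.1 hg).1 hne]

/-- `gval` reads only the variables of `C` and the AND slots of `G`. -/
theorem gval_congr (I : LocalMap 4 n m) (C : Finset (Fin n)) (G : Finset (Fin m)) {z z' : Fin n → Bool}
    (hC : ∀ v ∈ C, z v = z' v) (hG : ∀ g ∈ G, z (I.vars g 2) = z' (I.vars g 2) ∧ z (I.vars g 3) = z' (I.vars g 3)) :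
    gval I C G z = gval I C G z' := by
  unfold PstarGapOneAll.gval PstarPDT.parity
  have h1 : (C.filter fun v => z v = true) = C.filter fun v => z' v = true := filter_congr fun v hv => by rw [hC v hv]
  have h2 : (G.filter fun g => z (I.vars g 2) = true ∧ z (I.vars g 3) = true) =
      G.filter fun g => z' (I.vars g 2) = true ∧ z' (I.vars g 3) = true :=
    filter_congr fun g hg => by rw [(hG g hg).1, (hG g hg).2]
  rw [h1, h2]

include hI hT hRJ hR in
/-- **Substituted constraints do not read second tips**: two assignments that agree off the second tips of `R` give the same value. -/
theorem gval_sub_congr (C : Finset (Fin n)) (G : Finset (Fin m)) {z z' : Fin n → Bool}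
    (h : ∀ v, (∀ g ∈ R, I.vars g 1 ≠ v) → z v = z' v) :
    gval I (subC I R C) (subG I R C G) z = gval I (subC I R C) (subG I R C G) z' := by
  classical
  refine gval_congr I _ _ (fun v hv => h v fun g hg hgv => ?_) (fun g _ => ⟨h _ fun g' _ hne => ?_, h _ fun g' _ hne => ?_⟩)
  · unfold subC at hv
    rcases mem_symmDiff.1 hv with ⟨h1, -⟩ | ⟨h1, -⟩
    · exact (mem_sdiff.1 h1).2 (mem_image.2 ⟨g, hg, hgv⟩)
    · obtain ⟨g', hg', hv'⟩ := mem_image.1 h1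
      exact tip_ne_tip' I hI hRJ hR (mem_filter.1 hg').1 hg (hv'.trans hgv.symm)
  · exact hT g' g 1 2 (by decide) (by decide) hne
  · exact hT g' g 1 3 (by decide) (by decide) hne

include hI hT hRJ hR in
/-- **Correcting the readers.**  Every assignment can be changed on the second tips of `R` alone into one solving every reader of
`R`; no other output of `J` moves. -/
theorem exists_fix_readers (a : Fin n → Bool) :
    ∃ z : Fin n → Bool, (∀ g ∈ R, I.eval z g = y g) ∧ (∀ v, (∀ g ∈ R, I.vars g 1 ≠ v) → z v = a v) ∧
      ∀ j ∈ J, j ∉ R → I.eval z j = I.eval a j := by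
  classical
  set val : Fin m → Bool := fun g => xor (xor (a (I.vars g 0)) (y g)) (a (I.vars g 2) && a (I.vars g 3)) with hval
  set z : Fin n → Bool := fun v => if h : ∃ g, g ∈ R ∧ I.vars g 1 = v then val (Classical.choose h) else a v with hz
  have hz_tip' : ∀ g ∈ R, z (I.vars g 1) = val g := by
    intro g hg
    have hex : ∃ g', g' ∈ R ∧ I.vars g' 1 = I.vars g 1 := ⟨g, hg, rfl⟩
    simp only [hz, hex, dif_pos]
    have hspec := Classical.choose_spec hex
    rw [tip'_injOn I hRJ hR hspec.1 hg hspec.2]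
  have hz_other : ∀ v, (∀ g ∈ R, I.vars g 1 ≠ v) → z v = a v := by
    intro v hv
    have hno : ¬ ∃ g, g ∈ R ∧ I.vars g 1 = v := fun ⟨g, hg, hgv⟩ => hv g hg hgv
    simp only [hz, hno, dif_neg, not_false_eq_true]
  have hz_and : ∀ (j : Fin m) (s : Fin 4), 2 ≤ s.val → z (I.vars j s) = a (I.vars j s) := fun j s hs =>
    hz_other _ fun g _ h => hT g j 1 s (by decide) hs h
  have hz_tip : ∀ g ∈ R, z (I.vars g 0) = a (I.vars g 0) := fun g hg =>
    hz_other _ fun h hh heq => tip_ne_tip' I hI hRJ hR hg hh heq.symm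
  refine ⟨z, fun g hg => ?_, hz_other, fun j hj hjR => ?_⟩
  · have hvg : val g = xor (xor (a (I.vars g 0)) (y g)) (a (I.vars g 2) && a (I.vars g 3)) := rfl
    rw [eval_pure I hI, hz_tip g hg, hz_tip' g hg, hz_and g 2 (by decide), hz_and g 3 (by decide), hvg]
    cases a (I.vars g 0) <;> cases y g <;> cases (a (I.vars g 2) && a (I.vars g 3)) <;> rfl
  · refine eval_congr I j fun s => hz_other _ fun g hg hgs => ?_
    have hne : j ≠ g := fun h => hjR (h ▸ hg)
    exact tip'_not_mem_varSet I hR hg hj hne (hgs ▸ vars_mem_varSet I j s)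

end Readers

end Summit.PneNP.PneNP.Theorems.PstarReaderCore
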